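import Summits.HodgeConjecture.HodgeConjecture.Theorems.EndoscopicMiddleDegreeOrthogonalSplit
import Literature.AlgebraicGeometry.HodgeTheory.HardLefschetzHodgeRiemann

/-!
# Crux `AlgebraicOrEnveloped` (stmt-HodgeConjecture-14943) · line `Sketch` — stub `stub_algebraicKernelSplit`

The ALGEBRAIC-KERNEL SPLIT on the `2(m+1)`-fold `X` of a unitary ball quotient datum with the Hodge
conjecture in degree `2m`: every rational Hodge `(m+1,m+1)`-class `c` lies in
`algebraicClasses X (m+1) ⊔ span_ℂ {e rational Hodge (m+1,m+1) : e ∪ x = 0 for all x ∈ algebraicClasses X (m+1)}`.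

PROOF. `mem_sup_span_orthogonal` (file `EndoscopicMiddleDegreeOrthogonalSplit`) for the subspace
`T = span_ℂ S`, `S` = the algebraic rational Hodge `(m+1,m+1)`-classes:
* (T1) is tautological (`S ⊆ T`);
* (T2): for `b` rational Hodge `(m,m)` and `d ∈ N¹ H²`, `d` is a `ℂ`-combination of RATIONAL divisor
  classes `d'` (`supportedClasses_le_span_isRationalClass`), and each `b ∪ d'` is algebraic
  (`b` is algebraic by the degree-`2m` hypothesis, then `CupProductAlgebraic`), rational
  (`IsRationalClass.cup`) and of type `(m+1,m+1)` (cup product bigraded, de Rham's theorem in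
  multiplicative form; `d'` is of type `(1,1)` by Grothendieck's coniveau inclusion);
* `T = algebraicClasses X (m+1)`: `⊆` as `S ⊆ Alg`; `⊇` as every algebraic class is a `ℂ`-combination
  of rational algebraic classes, of type `(m+1,m+1)` by the coniveau inclusion, i.e. of elements of `S`;
  so `T`-orthogonality is `Alg`-orthogonality.
CONDITIONAL on the hypotheses `hK` (Kähler package: the Literature named fact
`Literature.AlgebraicGeometry.HodgeTheory.hardLefschetz_hodgeRiemann`), `hG` (coniveau inclusion), `hdR`
(de Rham's theorem, multiplicative form) and `hcup` (`CupProductAlgebraic`), all taken as arguments.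

LAYOUT. The stub theorem is declared with the `_root_` prefix in `namespace Summit.HodgeConjecture.HodgeConjecture`,
OUTSIDE the inner `namespace Theorems` block: inside that block the short name `hardLefschetz_hodgeRiemann`
of the registered stub signature would denote the Summits-side rendering
`Summit.HodgeConjecture.HodgeConjecture.Theorems.hardLefschetz_hodgeRiemann` (namespace-first name
resolution), whereas the line's skeleton — and hence the registered signature — means the Literature
named fact; outside the block (with `Literature.AlgebraicGeometry.HodgeTheory` open) it denotes the
Literature fact, so the theorem below has exactly the registered type.
-/

noncomputable section

-- mandated namespace `Summit.HodgeConjecture.HodgeConjecture.Theorems` (single-problem summit: Problem =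
-- Summit) trips `linter.dupNamespace`; off tree-wide in the lakefile, restated for stand-alone elaboration.
set_option linter.dupNamespace false

open CategoryTheory MonoidalCategory CartesianMonoidalCategory
open Literature.AlgebraicGeometry.Motives Literature.AlgebraicGeometry.HodgeTheory
open Literature.AlgebraicGeometry.ShimuraVarieties Literature.AlgebraicTopology.SingularHomology
open scoped Manifold

namespace Summit.HodgeConjecture.HodgeConjecture

namespace Theorems

/-- The Literature named fact `Literature.AlgebraicGeometry.HodgeTheory.hardLefschetz_hodgeRiemann d Y`
IS the Summits-side rendering `Summit.HodgeConjecture.HodgeConjecture.Theorems.hardLefschetz_hodgeRiemann d Y`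
consumed by `mem_sup_span_orthogonal` (identical bodies, definitional unfolding; the same bridge as
`hardLefschetz_hodgeRiemann_iff` of `EndoscopicMiddleDegreeOrthogonalSplitOfFacts`, restated privately so
that this file imports only the two modules it uses). [cite: VoisinHodgeI2002, Thm. 6.25, Thm. 6.32 and Thm. 7.10] -/
private theorem kaehlerPackage_of_literature {d : ℕ} {Y : SchemeOver ℂ}
    (h : Literature.AlgebraicGeometry.HodgeTheory.hardLefschetz_hodgeRiemann d Y) :
    Summit.HodgeConjecture.HodgeConjecture.Theorems.hardLefschetz_hodgeRiemann d Y :=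
  h

end Theorems

/-- **The algebraic-kernel split** (crux `AlgebraicOrEnveloped`, line `Sketch`, stub
`stub_algebraicKernelSplit`): on the `2(m+1)`-fold `X` of a unitary ball quotient datum, granted the
Hodge conjecture for rational `(m,m)`-classes in degree `2m`, every rational Hodge `(m+1,m+1)`-class
lies in `algebraicClasses X (m+1) ⊔ span_ℂ {e rational Hodge (m+1,m+1) : e ∪ algebraicClasses X (m+1) = 0}`
— `mem_sup_span_orthogonal` for `T` = the span of the algebraic rational Hodge classes, which equals
`algebraicClasses X (m+1)` (rational supported classes span, coniveau inclusion) and contains the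
Lefschetz products `b ∪ d` (`CupProductAlgebraic`, cup product bigraded). Conditional on the Kähler
package `hK` (the Literature named fact `Literature.AlgebraicGeometry.HodgeTheory.hardLefschetz_hodgeRiemann`,
which the short name denotes here, outside the inner `Theorems` namespace block), Grothendieck's coniveau
inclusion `hG`, de Rham's theorem in multiplicative form `hdR` and `CupProductAlgebraic`.
[cite: VoisinHodgeI2002, §6.3.2 Thm. 6.32 and §7.1.2] [cite: GrothendieckTopology1969, p. 299 (∗) and p. 300] -/
theorem _root_.Summit.HodgeConjecture.HodgeConjecture.Theorems.stub_algebraicKernelSplit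
    (hK : ∀ (d : ℕ) (Y : SchemeOver ℂ), hardLefschetz_hodgeRiemann d Y)
    (hG : Grothendieck1969_supportedClasses_le_hodgeConiveau)
    (hdR : ∀ (E : Type) [NormedAddCommGroup E] [NormedSpace ℂ E] [FiniteDimensional ℂ E],
      Literature.NumberTheory.Transcendental.exists_deRhamIsoFamily 𝓘(ℝ, E))
    (hcup : Theses.EndoscopicMiddleDegree.CupProductAlgebraic) :
    ∀ (m : ℕ) (X : SchemeOver ℂ) (_D : UnitaryBallQuotientDatum (2 * (m + 1)) X), 1 ≤ m → m ≤ 2 →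
    (∀ a : complexBetti X (2 * m), IsRationalClass a →
      IsOfHodgeType (2 * (m + 1)) X (2 * m) m m a → a ∈ algebraicClasses X m) →
    ∀ c : complexBetti X (2 * (m + 1)), IsRationalClass c →
      IsOfHodgeType (2 * (m + 1)) X (2 * (m + 1)) (m + 1) (m + 1) c →
      c ∈ algebraicClasses X (m + 1) ⊔ Submodule.span ℂ {e : complexBetti X (2 * (m + 1)) |
        IsRationalClass e ∧ IsOfHodgeType (2 * (m + 1)) X (2 * (m + 1)) (m + 1) (m + 1) e ∧
        ∀ x ∈ algebraicClasses X (m + 1),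
          cupProduct (two_mul_add_two_mul (m + 1) (m + 1)) e x = 0} := by
  intro m X D _ _ hlow c hcQ hcT
  have hX : IsSmoothProjective (2 * (m + 1)) X := D.isSmoothProjective
  obtain ⟨A, hcA⟩ := hcT
  have hI : hodgePQ_independent_of_hodgeModel := hodgePQ_independent_of_hodgeModel_holds
  have hcupT : CupPreservesHodgeType (2 * (m + 1)) X :=
    cupPreservesHodgeType_of_exists_deRhamIsoFamily hI hX A (hdR A.model)
  -- algebraic classes are of Hodge type `(k,k)` (coniveau inclusion), tested in the model `A`
  have hAlgT : ∀ {k : ℕ} {x : complexBetti X (2 * k)}, x ∈ algebraicClasses X k →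
      IsOfHodgeType (2 * (m + 1)) X (2 * k) k k x := fun hx ↦
    ⟨A, Theorems.pullback_mem_hodgePQ_of_mem_supportedClasses hG hX A hx⟩
  -- `S`: the algebraic rational Hodge `(m+1,m+1)`-classes; `T = span S`
  set S : Set (complexBetti X (2 * (m + 1))) := {x | x ∈ algebraicClasses X (m + 1) ∧
      IsRationalClass x ∧ IsOfHodgeType (2 * (m + 1)) X (2 * (m + 1)) (m + 1) (m + 1) x}
  have hTalg : Submodule.span ℂ S ≤ algebraicClasses X (m + 1) :=
    Submodule.span_le.2 fun x hx ↦ hx.1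
  have halgT : algebraicClasses X (m + 1) ≤ Submodule.span ℂ S := by
    intro x hx
    refine Submodule.span_mono ?_
      (supportedClasses_le_span_isRationalClass hX (2 * (m + 1)) (m + 1) hx)
    rintro y ⟨hyQ, hyN⟩
    exact ⟨hyN, hyQ, hAlgT hyN⟩
  have hT1 : Submodule.span ℂ S ≤ Submodule.span ℂ {x : complexBetti X (2 * (m + 1)) |
      x ∈ Submodule.span ℂ S ∧ IsRationalClass x ∧
        IsOfHodgeType (2 * (m + 1)) X (2 * (m + 1)) (m + 1) (m + 1) x} :=
    Submodule.span_mono fun x hx ↦ ⟨Submodule.subset_span hx, hx.2⟩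
  have hT2 : ∀ b : complexBetti X (2 * m), IsRationalClass b →
      IsOfHodgeType (2 * (m + 1)) X (2 * m) m m b → ∀ d ∈ algebraicClasses X 1,
        cupProduct (two_mul_add_two_mul m 1) b d ∈ Submodule.span ℂ S := by
    intro b hbQ hbT d hd
    have hd' := supportedClasses_le_span_isRationalClass hX (2 * 1) 1 hd
    have hz := Submodule.mem_map_of_mem (f := cupProduct (two_mul_add_two_mul m 1) b) hd'
    rw [Submodule.map_span] at hz
    refine Submodule.span_mono ?_ hz
    rintro _ ⟨d', ⟨hd'Q, hd'N⟩, rfl⟩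
    exact ⟨hcup hX m 1 b d' (hlow b hbQ hbT) hd'N, hbQ.cup _ hd'Q,
      hcupT (two_mul_add_two_mul m 1) hbT (hAlgT hd'N)⟩
  have key := Theorems.mem_sup_span_orthogonal (Theorems.kaehlerPackage_of_literature (hK _ X)) hX A
    (Submodule.span ℂ S) hT1 hT2 hcQ hcA
  refine SetLike.le_def.1 (sup_le_sup hTalg (Submodule.span_mono ?_)) key
  rintro e ⟨heQ, heT, horth⟩
  exact ⟨heQ, heT, fun x hx ↦ horth x (halgT hx)⟩

end Summit.HodgeConjecture.HodgeConjecture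

end
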